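import Summits.AtomisticToContinuum.HydrodynamicLimit.Theorems.OneFlightGossipEngineClampedTransferDockCubicChannelRateBand
import HarnessLib

/-!
# The signed rate cubic channel — the two-sided entropy step for a bounded window functional and the top cube
# (helpers for the registered stub `stub_cubicChannelRateS` of line `IdeatorOneSketch`, crux `HydroLimitInBand`,
# stmt-AtomisticToContinuum-9133, skeleton v16)

Skeleton v16 re-threads the landed rate dock around the refuted band-coherence input (BCL, stmt-17700): the band part of the
suprathermal heat-flux remainder is paid SIGNED. This file holds the two model-independent pieces of that payment:

* `signedWindow_expectation` — for a bounded continuous one-body functional `F` and a tilt `β > 0`, the two reference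
  exponential moments `∫ exp(±β Σ_i w⁻¹∫₀ʷ F(Φ_r z)_i dr) dψ ≤ e^B` give, under the TRUE law `λ`,
  `E_λ |∫_s^{s+w} Σ_i F(Φ_r z)_i dr| ≤ (w/β)(KL(f_s ‖ ψ) + log 2 + B)` — the landed entropy step
  `ClampedCurrentsDockEntropyStep.stub_windowEntropyStep` applied to `Y = |Σ_i ∫₀ʷ F|` at the tilt `β/w`
  (`e^{|x|} ≤ eˣ + e^{−x}`);
* `top_cube_le` — above the level, the peculiar cube is a lab-frame cubic tail:
  `1{K₁ < ‖v − a‖}‖v − a‖³ ≤ 8 · 1{K₁ − U < ‖v‖}‖v‖³` for `‖a‖ ≤ U`, `2U ≤ K₁`.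

References: H.-T. Yau, Lett. Math. Phys. 22 (1991) §2 (entropy inequality); B. Nachtergaele, H.-T. Yau, Comm. Math. Phys. 243
(2003) §5 (two-sided use for the truncated signed energy current). prover-line-stmt-AtomisticToContinuum-9133-c17-0 (lead).
-/

noncomputable section

namespace Summit.AtomisticToContinuum.HydrodynamicLimit.Theorems.HydroLimitInBandCubicChannelS

open scoped BigOperators ENNReal Classical Interval
open MeasureTheory Filter Set Topology InformationTheory
open Literature.MathematicalPhysics.KineticTheory Literature.Analysis.FluidPDE Literature.Analysis.FunctionSpaces
open Summit.AtomisticToContinuum.HydrodynamicLimit.Theorems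
open Summit.AtomisticToContinuum.HydrodynamicLimit.Theorems.EntropyClockDock (ae_mem_good_localGibbsLaw)
open Summit.AtomisticToContinuum.HydrodynamicLimit.Theorems.ClampedCurrentsDockCubicPathwise (intervalIntegrable_orbit)
open Summit.AtomisticToContinuum.HydrodynamicLimit.Theorems.ClampedCurrentsDockEntropyStep
  (stub_windowEntropyStep intervalIntegral_shift_flow)

variable {σ : ℝ} {N : ℕ}

/-! ## §1 The top cube -/

/-- **The top of the peculiar cube is a lab-frame cubic tail**: for `‖a‖ ≤ U` and `2U ≤ K₁`,
`1{K₁ < ‖v − a‖}‖v − a‖³ ≤ 8 · 1{K₁ − U < ‖v‖}‖v‖³` (above the level, `‖v‖ > K₁ − U ≥ U ≥ ‖a‖`, so `‖v − a‖ ≤ 2‖v‖`).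
[folklore] -/
theorem top_cube_le {v a : V3} {U K₁ : ℝ} (ha : ‖a‖ ≤ U) (hK₁ : 2 * U ≤ K₁) :
    (if K₁ < ‖v - a‖ then ‖v - a‖ ^ 3 else 0) ≤ 8 * Set.indicator {w : V3 | K₁ - U < ‖w‖} (fun w => ‖w‖ ^ 3) v := by
  have hI0 : 0 ≤ Set.indicator {w : V3 | K₁ - U < ‖w‖} (fun w => ‖w‖ ^ 3) v :=
    Set.indicator_nonneg (fun _ _ => by positivity) _
  split_ifs with h
  · have hva : ‖v - a‖ ≤ ‖v‖ + ‖a‖ := norm_sub_le v a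
    have hU : 0 ≤ U := (norm_nonneg a).trans ha
    have hv : K₁ - U < ‖v‖ := by linarith
    rw [Set.indicator_of_mem (show v ∈ {w : V3 | K₁ - U < ‖w‖} from hv)]
    have h2 : ‖v - a‖ ≤ 2 * ‖v‖ := by linarith
    have h3 : ‖v - a‖ ^ 3 ≤ (2 * ‖v‖) ^ 3 := pow_le_pow_left₀ (norm_nonneg _) h2 3
    nlinarith [h3, norm_nonneg v]
  · positivity

/-! ## §2 The two-sided entropy step for a bounded window functional -/

/-- `e^{|x|} ≤ eˣ + e^{−x}`. [folklore] -/
theorem exp_abs_le (x : ℝ) : Real.exp |x| ≤ Real.exp x + Real.exp (-x) := by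
  rcases le_or_gt 0 x with h | h
  · rw [abs_of_nonneg h]; exact le_add_of_nonneg_right (Real.exp_pos _).le
  · rw [abs_of_neg h]; exact le_add_of_nonneg_left (Real.exp_pos _).le

/-- **The two-sided entropy step for a bounded window functional.** Let `F` be a bounded continuous one-body functional,
`λ = localGibbsLaw σ a₀ u₀ θ₀ N Φ` the true law and `ψ = localGibbsLaw σ b us ϑ N Φ` a reference local Gibbs law. If for a tilt
`β > 0` both reference exponential moments of the window average are bounded,
`∫ exp(± β Σ_i w⁻¹ ∫₀ʷ F(Φ_r z)_i dr) dψ ≤ e^B`, then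
`E_λ |∫_s^{s+w} Σ_i F(Φ_r z)_i dr| ≤ (w/β) (KL(f_s ‖ ψ) + log 2 + B)`.
Proof: the landed one-channel entropy step (`ClampedCurrentsDockEntropyStep.stub_windowEntropyStep`) with zero streaming part and the
bounded functional `Y(z) = |Σ_i ∫₀ʷ F(Φ_r z)_i dr|` (measurable on the good set) at the tilt `γ = β/w`, whose reference moment is
bounded by `e^{|x|} ≤ eˣ + e^{−x}`; on the good set `Y ∘ Φ_s` is the window functional of `[s, s+w]` (flow shift, and the finite sum
commutes with the interval integral of the continuous orbit functionals). [cite: Yau1991, §2] -/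
theorem signedWindow_expectation : ∀ {σ : ℝ} {N : ℕ} (Φ : HardSphereFlow (Torus.geometry (Fin 3)) (hsDiameter σ N) (N + 1))
    {a₀ θ₀ b ϑ : T3 → ℝ} {u₀ us : T3 → V3} {F : T3 × V3 → ℝ} {Mb β B s w : ℝ},
    0 < σ → σ < 1 / 2 → Continuous a₀ → Continuous θ₀ → Continuous u₀ → (∀ x, 0 < a₀ x) → (∀ x, 0 < θ₀ x) →
    Continuous b → Continuous ϑ → Continuous us → (∀ x, 0 < b x) → (∀ x, 0 < ϑ x) →
    Continuous F → (∀ y, |F y| ≤ Mb) → 0 ≤ s → 0 < w → 0 < β →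
    ∫⁻ z, ENNReal.ofReal (Real.exp (β * ∑ i : Fin (N + 1), w⁻¹ * ∫ r in (0 : ℝ)..w, F (Φ.flow r z i)))
      ∂(localGibbsLaw σ b us ϑ N Φ) ≤ ENNReal.ofReal (Real.exp B) →
    ∫⁻ z, ENNReal.ofReal (Real.exp (-β * ∑ i : Fin (N + 1), w⁻¹ * ∫ r in (0 : ℝ)..w, F (Φ.flow r z i)))
      ∂(localGibbsLaw σ b us ϑ N Φ) ≤ ENNReal.ofReal (Real.exp B) →
    ∫⁻ z, ENNReal.ofReal |∫ r in s..(s + w), ∑ i : Fin (N + 1), F (Φ.flow r z i)| ∂(localGibbsLaw σ a₀ u₀ θ₀ N Φ) ≤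
      ENNReal.ofReal (w / β *
        ((klDiv (Φ.lawAt (localGibbsLaw σ a₀ u₀ θ₀ N Φ) s) (localGibbsLaw σ b us ϑ N Φ)).toReal + Real.log 2 + B)) := by
  intro σ N Φ a₀ θ₀ b ϑ u₀ us F Mb β B s w hσ hσ2 ha hθ hu ha0 hθ0 hb hϑ hus hb0 hϑ0 hF hFb hs hw hβ hplus hminus
  haveI := isProbabilityMeasure_localGibbsLaw ha hθ hu ha0 hθ0 hσ2.le N Φ
  have hMb : 0 ≤ Mb := (abs_nonneg _).trans (hFb (Classical.arbitrary _))
  -- the bounded functional of the window `[0, w]`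
  set Y0 : Config (N + 1) (Fin 3) T3 → ℝ := fun z => |∑ i : Fin (N + 1), ∫ r in (0 : ℝ)..w, F (Φ.flow r z i)| with hY0
  have hY0bd : ∀ z, |Y0 z| ≤ ((N : ℝ) + 1) * (w * Mb) := by
    intro z
    rw [hY0, abs_abs]
    refine (Finset.abs_sum_le_sum_abs _ _).trans ?_
    have hi : ∀ i : Fin (N + 1), |∫ r in (0 : ℝ)..w, F (Φ.flow r z i)| ≤ w * Mb := by
      intro i
      have hK : ∀ r ∈ Ι (0 : ℝ) w, ‖F (Φ.flow r z i)‖ ≤ Mb := fun r _ => by rw [Real.norm_eq_abs]; exact hFb _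
      have h := intervalIntegral.norm_integral_le_of_norm_le_const hK
      rw [sub_zero, abs_of_pos hw, Real.norm_eq_abs] at h
      linarith
    calc ∑ i : Fin (N + 1), |∫ r in (0 : ℝ)..w, F (Φ.flow r z i)| ≤ ∑ _i : Fin (N + 1), w * Mb :=
          Finset.sum_le_sum fun i _ => hi i
      _ = ((N : ℝ) + 1) * (w * Mb) := by
          rw [Finset.sum_const, Finset.card_univ, Fintype.card_fin, nsmul_eq_mul]; push_cast; ring
  -- measurability on the good set and a measurable version
  have hY0g : Measurable fun z : Φ.good => Y0 z := by
    simp only [hY0]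
    exact (ClampedCurrentsDockHeart.measurable_sum_windowIntegral Φ hF 0 w).abs
  obtain ⟨Ym, hYm, hYmeq⟩ := ClampedCurrentsDockHeart.exists_measurable_eqOn_good Φ hY0g
  -- the reference exponential moment of `γ Y0`, `γ = β / w`, from the two signed moments
  have hγ : 0 < β / w := div_pos hβ hw
  have hsum : ∀ z, β / w * Y0 z = |β * ∑ i : Fin (N + 1), w⁻¹ * ∫ r in (0 : ℝ)..w, F (Φ.flow r z i)| := by
    intro z
    have e1 : (∑ i : Fin (N + 1), w⁻¹ * ∫ r in (0 : ℝ)..w, F (Φ.flow r z i)) =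
        w⁻¹ * ∑ i : Fin (N + 1), ∫ r in (0 : ℝ)..w, F (Φ.flow r z i) := by rw [Finset.mul_sum]
    show β / w * |∑ i : Fin (N + 1), ∫ r in (0 : ℝ)..w, F (Φ.flow r z i)| = _
    rw [e1, abs_mul, abs_mul, abs_of_pos hβ, abs_of_pos (inv_pos.2 hw)]
    ring
  have hgoodψ : (localGibbsLaw σ b us ϑ N Φ) Φ.goodᶜ = 0 := mem_ae_iff.1 (ae_mem_good_localGibbsLaw σ b ϑ us N Φ)
  have hXm : AEMeasurable (fun z => ∑ i : Fin (N + 1), w⁻¹ * ∫ r in (0 : ℝ)..w, F (Φ.flow r z i))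
      (localGibbsLaw σ b us ϑ N Φ) :=
    Finset.aemeasurable_fun_sum _ fun i _ =>
      (Φ.aemeasurable_intervalIntegral_comp_flow_torus (f := fun c => F (c i))
        (hF.measurable.comp (measurable_pi_apply i)) 0 w hgoodψ).const_mul _
  have hEm : AEMeasurable (fun z => ENNReal.ofReal (Real.exp (β * ∑ i : Fin (N + 1), w⁻¹ * ∫ r in (0 : ℝ)..w,
      F (Φ.flow r z i)))) (localGibbsLaw σ b us ϑ N Φ) :=
    (Real.measurable_exp.comp_aemeasurable (hXm.const_mul β)).ennreal_ofReal
  have hB2 : ∫⁻ z, ENNReal.ofReal (Real.exp (β / w * ((∑ i : Fin (N + 1), w⁻¹ * ∫ r in (0 : ℝ)..w,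
      (fun _ : T3 × V3 => (0 : ℝ)) (Φ.flow r z i)) + Y0 z))) ∂(localGibbsLaw σ b us ϑ N Φ) ≤
      ENNReal.ofReal (Real.exp (B + Real.log 2)) := by
    simp only [intervalIntegral.integral_zero, mul_zero, Finset.sum_const_zero, zero_add]
    calc ∫⁻ z, ENNReal.ofReal (Real.exp (β / w * Y0 z)) ∂(localGibbsLaw σ b us ϑ N Φ)
        ≤ ∫⁻ z, (ENNReal.ofReal (Real.exp (β * ∑ i : Fin (N + 1), w⁻¹ * ∫ r in (0 : ℝ)..w, F (Φ.flow r z i))) +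
            ENNReal.ofReal (Real.exp (-β * ∑ i : Fin (N + 1), w⁻¹ * ∫ r in (0 : ℝ)..w, F (Φ.flow r z i))))
            ∂(localGibbsLaw σ b us ϑ N Φ) := by
          refine lintegral_mono fun z => ?_
          rw [hsum z, ← ENNReal.ofReal_add (Real.exp_pos _).le (Real.exp_pos _).le, neg_mul]
          exact ENNReal.ofReal_le_ofReal (exp_abs_le _)
      _ ≤ ENNReal.ofReal (Real.exp B) + ENNReal.ofReal (Real.exp B) := by
          rw [lintegral_add_left' hEm]
          exact add_le_add hplus hminus
      _ = ENNReal.ofReal (Real.exp (B + Real.log 2)) := by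
          rw [← ENNReal.ofReal_add (Real.exp_pos _).le (Real.exp_pos _).le, Real.exp_add, Real.exp_log two_pos]
          ring_nf
  -- the landed entropy step with zero streaming part
  obtain ⟨hI, hle⟩ := stub_windowEntropyStep σ N Φ a₀ θ₀ u₀ b ϑ us (fun _ => 0) Y0 Ym 0
    (((N : ℝ) + 1) * (w * Mb)) (β / w) (B + Real.log 2) s w hσ hσ2 ha hθ hu ha0 hθ0 hb hϑ hus hb0 hϑ0 continuous_const
    (fun y => by simp) hYm hYmeq (fun z _ => hY0bd z) hs hw hγ hB2
  simp only [intervalIntegral.integral_zero, mul_zero, Finset.sum_const_zero, zero_add] at hI hle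
  -- the functional of the window `[s, s+w]` is `Y0 ∘ Φ_s` on the good set
  have key : ∫⁻ z, ENNReal.ofReal (Y0 (Φ.flow s z)) ∂(localGibbsLaw σ a₀ u₀ θ₀ N Φ) ≤ ENNReal.ofReal (w / β *
      ((klDiv (Φ.lawAt (localGibbsLaw σ a₀ u₀ θ₀ N Φ) s) (localGibbsLaw σ b us ϑ N Φ)).toReal + Real.log 2 + B)) := by
    rw [← ofReal_integral_eq_lintegral_ofReal hI (ae_of_all _ fun z => by rw [hY0]; exact abs_nonneg _)]
    refine ENNReal.ofReal_le_ofReal (hle.trans_eq ?_)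
    rw [inv_div]; ring
  refine le_of_eq_of_le (lintegral_congr_ae ?_) key
  filter_upwards [ae_mem_good_localGibbsLaw σ a₀ θ₀ u₀ N Φ] with z hz
  rw [hY0]
  congr 2
  rw [intervalIntegral.integral_finsetSum fun i _ => intervalIntegrable_orbit Φ hz hF i s (s + w)]
  exact Finset.sum_congr rfl fun i _ => intervalIntegral_shift_flow Φ F i s w hz

end Summit.AtomisticToContinuum.HydrodynamicLimit.Theorems.HydroLimitInBandCubicChannelS

end
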